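import Mathlib
import Summits.Ventures.PercRepro2.Defs
import Summits.Ventures.PercRepro2.Independence
import Summits.Ventures.PercRepro2.Harris
import Summits.Ventures.PercRepro2.Graph
import Summits.Ventures.PercRepro2.Exploration
import Summits.Ventures.PercRepro2.Induced
import Summits.Ventures.PercRepro2.R2PrimeThreeReduction
import Summits.Ventures.PercRepro2.YBridge
import Summits.Ventures.PercRepro2.HCov
import Summits.Ventures.PercRepro2.HCovFns
import Summits.Ventures.PercRepro2.HCovCubic
import Summits.Ventures.PercRepro2.TriDisagreement
import Summits.Ventures.PercRepro2.TriDisagreementPinned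
import Summits.Ventures.PercRepro2.HCovTyped
import Summits.Ventures.PercRepro2.DAD
import Summits.Ventures.PercRepro2.HubModel
import Summits.Ventures.PercRepro2.HubLaw
import Summits.Ventures.PercRepro2.HubRootLaw
import Summits.Ventures.PercRepro2.HubConn
import Summits.Ventures.PercRepro2.HubBernstein
import Summits.Ventures.PercRepro2.HubGc
import Summits.Ventures.PercRepro2.HubKron
import Summits.Ventures.PercRepro2.HubCert
import Summits.Ventures.PercRepro2.HubCertPart1
import Summits.Ventures.PercRepro2.HubCertPart2
import Summits.Ventures.PercRepro2.HubCertPart3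
import Summits.Ventures.PercRepro2.HubCertPart4
import Summits.Ventures.PercRepro2.HubCertPart5
import Summits.Ventures.PercRepro2.HubCertPart6
import Summits.Ventures.PercRepro2.HubCertAll
import Summits.Ventures.PercRepro2.HubKernelChunk0
import Summits.Ventures.PercRepro2.HubKernelChunk1
import Summits.Ventures.PercRepro2.HubKernelChunk2
import Summits.Ventures.PercRepro2.HubKernelChunk3
import Summits.Ventures.PercRepro2.HubHarris
import Summits.Ventures.PercRepro2.HubTheorem
import Summits.Ventures.PercRepro2.HubKernelP1
import Summits.Ventures.PercRepro2.HubKernelP1Cert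
import Summits.Ventures.PercRepro2.HubKernelP1Chunk0
import Summits.Ventures.PercRepro2.HubKernelP1Chunk1
import Summits.Ventures.PercRepro2.HubKernelP1Chunk2
import Summits.Ventures.PercRepro2.HubKernelP1Chunk3
import Summits.Ventures.PercRepro2.HubKernelP1Chunk4
import Summits.Ventures.PercRepro2.HubTyped
import Summits.Ventures.PercRepro2.HubTypedProfile
import Summits.Ventures.PercRepro2.HubFibre
import Summits.Ventures.PercRepro2.HubPair

/-!
# THE TYPED R THEOREM: row 2′TRI holds on the class R
(blind cell PercRepro2, typer-1 g8; NIGHT3-CERT.md §11, the typed strengthening of the hub theorem)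

**Theorem** (`TypedBases_of_classR`).  For five distinct marks (`markOf` injective) such that
every edge at a root joins two marks (`ClassR`), every typed three-copy count of p1's kernel `K₃`
with types in `{1, 2}` on the typed edges is nonnegative: `CovForm.TypedBases ends o a₁ a₂ a₃ b`
— every Bernstein coefficient of the covariance form, not only its value on `[0, 1]^E`.

Proof.  The typed hub decomposition (`typedCount_eq_gamma_Wtot`) writes the typed count as
`Σ_k gamma k · Σ_π Ninner π · W^{K₃}_k(π)` with `gamma ≥ 0`; the inner count lives on the atoms
(`sum_Ninner_eq_pair5`), where the pairing with the hub table of `K₃` is nonnegative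
(`pair5_W5K3_nonneg`): the kernel-checked coefficient identity `2 · sym3 (W5K3 k) = rhsK certList k`
(`coeff_identityK3`, from `hub_checkK3_0` … `hub_checkK3_4` — the same 330 certificates as the
weighted theorem), the symmetry of the inner count (`N5_sym`, `pair5_sym3`), the nonnegativity of
the certificate multipliers (`cert_nonneg`) and the fibre-Harris block inequalities
(`block_nonneg_N5`).  Everything is kernel-checked; no `native_decide`.
-/

namespace Summit.Ventures.PercRepro2.Hub

section Coefficient

/-- **The kernel check for `K₃`**, assembled. -/
theorem hub_checkK3 : ∀ a b d : Fin 5, 2 * kronSymK3 a b d = certNum a b d := by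
  intro a
  fin_cases a
  · exact hub_checkK3_0
  · exact hub_checkK3_1
  · exact hub_checkK3_2
  · exact hub_checkK3_3
  · exact hub_checkK3_4

/-- The doubled symmetrised hub table of `K₃` is a balanced digit vector. -/
lemma abs_two_sym3_W5K3_lt (k : Fin 7 → Fin 4) (a b d : Fin 5) :
    |2 * sym3 (W5K3 k) a b d| < 2 ^ 31 := by
  unfold sym3 W5K3
  have h1 := abs_le.1 (abs_WtotK3_le k (atomPat a) (atomPat b) (atomPat d))
  have h2 := abs_le.1 (abs_WtotK3_le k (atomPat a) (atomPat d) (atomPat b))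
  have h3 := abs_le.1 (abs_WtotK3_le k (atomPat b) (atomPat a) (atomPat d))
  have h4 := abs_le.1 (abs_WtotK3_le k (atomPat b) (atomPat d) (atomPat a))
  have h5 := abs_le.1 (abs_WtotK3_le k (atomPat d) (atomPat a) (atomPat b))
  have h6 := abs_le.1 (abs_WtotK3_le k (atomPat d) (atomPat b) (atomPat a))
  rw [abs_lt]
  constructor <;> linarith

/-- **THE COEFFICIENT IDENTITY FOR `K₃`**: the doubled symmetrised hub table of p1's kernel equals
the symmetrised certificates. -/
theorem coeff_identityK3 (k : Fin 7 → Fin 4) (a b d : Fin 5) :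
    2 * sym3 (W5K3 k) a b d = rhsK certList k a b d := by
  have hL : ∀ e ∈ certList, e.1 < 16384 := by
    have := cert_keys
    rw [List.all_eq_true] at this
    intro e he
    simpa using this e he
  have h := hub_checkK3 a b d
  unfold certNum at h
  rw [list_sum_eq_sum_fiber certList hL (fun c => sym3 (rhs c) a b d), kronSymK3_eq,
    Finset.mul_sum] at h
  have h' : ∑ k, (2 * sym3 (W5K3 k) a b d) * KB ^ idx4K k =
      ∑ k, rhsK certList k a b d * KB ^ idx4K k := by
    simp only [rhsK]
    rw [← h]
    exact Finset.sum_congr rfl fun k _ => by ring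
  have hb : ∀ k, |rhsK certList k a b d| < 2 ^ 31 := by
    intro k
    have h1 := abs_filter_sum_le certList (fun e => decide (e.1 = idx4K k))
      (fun c => sym3 (rhs c) a b d)
    have h2 := cert_bound a b d
    unfold rhsK
    exact lt_of_le_of_lt h1 h2
  have key := digits_unique_idx (fun k => 2 * sym3 (W5K3 k) a b d) (fun k => rhsK certList k a b d)
    (fun k => abs_two_sym3_W5K3_lt k a b d) hb h'
  exact congrFun key k

end Coefficient

section Positivity

variable {S : Type*} [Field S] [LinearOrder S] [IsStrictOrderedRing S]

/-- **The hub table of `K₃` pairs nonnegatively with every symmetric tensor satisfying the block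
inequalities.** -/
theorem pair5_W5K3_nonneg (k : Fin 7 → Fin 4) (N : Fin 5 → Fin 5 → Fin 5 → ℕ) (hN : Sym N)
    (hblock : ∀ u v j, 0 ≤ ∑ a, ∑ b, (Aq u v a b : S) * (N a b j : S)) :
    0 ≤ pair5 (S := S) (W5K3 k) N := by
  have hL := cert_nonneg
  rw [List.all_eq_true] at hL
  have key : 0 ≤ (12 : S) * pair5 (S := S) (W5K3 k) N := by
    have e1 : (12 : S) * pair5 (S := S) (W5K3 k) N =
        pair5 (S := S) (fun a b d => 2 * sym3 (W5K3 k) a b d) N := by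
      have : pair5 (S := S) (fun a b d => 2 * sym3 (W5K3 k) a b d) N =
          2 * pair5 (S := S) (sym3 (W5K3 k)) N := by
        simp only [pair5, Int.cast_mul, Int.cast_ofNat, mul_assoc, Finset.mul_sum]
      rw [this, pair5_sym3 _ hN]
      ring
    rw [e1]
    have e2 : (fun a b d => 2 * sym3 (W5K3 k) a b d) = rhsK certList k := by
      funext a b d
      exact coeff_identityK3 k a b d
    rw [e2]
    unfold rhsK
    rw [pair5_list_sum]
    refine List.sum_nonneg fun x hx => ?_
    obtain ⟨e, he, rfl⟩ := List.mem_map.1 hx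
    rw [pair5_sym3 _ hN]
    have hc := hL e (List.mem_of_mem_filter he)
    exact mul_nonneg (by norm_num) (pair5_rhs_nonneg e.2 hc N hblock)
  by_contra hneg
  rw [not_le] at hneg
  have : (12 : S) * pair5 (S := S) (W5K3 k) N < 0 := mul_neg_of_pos_of_neg (by norm_num) hneg
  linarith

variable {V : Type*} {E : Type*} [Fintype E] [DecidableEq E] [DecidableEq V]

/-- **THE TYPED R THEOREM** — row 2′TRI on the class R: for five distinct marks with every root
edge joining two marks, every typed three-copy count of `K₃` with types in `{1, 2}` on the typed
edges is nonnegative. -/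
theorem TypedBases_of_classR (ends : E → Sym2 V) (o a₁ a₂ a₃ b : V)
    (hinj : Function.Injective (markOf o a₁ a₂ a₃ b)) (hR : ClassR ends (markOf o a₁ a₂ a₃ b)) :
    CovForm.TypedBases (R := S) ends o a₁ a₂ a₃ b := by
  intro F z τ hτ
  rw [typedCount_eq_gamma_Wtot ends o a₁ a₂ a₃ b hinj hR F z τ]
  refine Finset.sum_nonneg fun k _ => mul_nonneg (Nat.cast_nonneg _) ?_
  rw [sum_Ninner_eq_pair5]
  exact pair5_W5K3_nonneg k (N5 ends (markOf o a₁ a₂ a₃ b) F z τ)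
    (N5_sym F z τ) fun u v j => block_nonneg_N5 F z τ hτ u v j

end Positivity

end Summit.Ventures.PercRepro2.Hub
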